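import Literature.NumberTheory.Automorphic.UnitaryThreeAnisotropicStabilizerCosetEquiv        -- ★ FILE 2e-γ (this seat): the classifying bijection with first coordinate `q∕s`
import Literature.NumberTheory.Automorphic.UnitaryThreeAnisotropicFixedPointBracketClass     -- ★ FILE 3 (iii-b) part 2a (this seat): `B(u,n)`, perturbation
import Literature.NumberTheory.Automorphic.UnitaryThreeAnisotropicFixedPointCriterion         -- ★ B-p14 (ii-a)
import Literature.NumberTheory.Automorphic.UnitaryThreeAnisotropicFixedPointRegimes           -- ★ B-p14 (ii-b)
import Literature.NumberTheory.Automorphic.UnitOrbitalIntegralUnfoldingAnisotropic            -- ★ (F2′)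
import Literature.NumberTheory.Automorphic.UnitaryThreeAnisotropicFixedPointCountLow            -- ★ (iii-a) (for B-p10 (g25)'s §3 below)
import Literature.NumberTheory.Automorphic.UnitaryThreeAnisotropicFixedPointRegimeTwo          -- ★ B-p10 (g25) β p842039: the `q∕s`-count `q^N` (for §3 below)
import HarnessLib

/-!
# Prop. 16 for `m ≤ N`: `#Fix_t(S ⧸ H′_m) = #{ū ∈ 𝒪⧸𝔭^m : |B(u, n(u))| ≤ |ϖ^{2m+1}|} · #{norm-one residues mod 𝔭^{2m+1}}` — the fixed-point count REDUCED TO A RESIDUE COUNT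
# (Flicker 1998, Prop. 16 p. 96 — LAYER B′ step 2, FILE 3 (iii-b), part 2b)

Topic `NumberTheory/Automorphic`; namespace `Literature.NumberTheory.Automorphic.UnitaryGroup`.  THEOREMS ONLY (no `def`, no instance, no notation, no named fact, no
`sorry`; count-neutral).  Cell `pub/hodgecm-mathlib`, F0∕P3a road «D-N7-inert», line «N7nsCount» ((F11-c) `stub_irredGValueNeg`); LAYER B′ design pen + cutting hand
A-p13 (g30).  HONEST LABEL: HC_CM is proved only modulo the printed citations until rung 0 closes.  After this file the ONLY missing piece of Prop. 16's per-`m` counts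
is the pure residue count `#{ū ∈ 𝒪⧸𝔭^m : |B(u, n(u))| ≤ |ϖ^{2m+1}|} = q^N` in the row `[N∕2] < m ≤ N ∧ N < M` (part 2c; a `σ`-semilinear congruence mod `𝔭^{2m−N}`).

THE MATHEMATICS.  `t ∈ S` of exponent `N` (`|q_t| = |r_t| = |ϖ|^N`, `|A_t − s_t| ≤ |ϖ|^{N+1}`), `m ≤ N`, `Δ_t := A_t∕σs_t`.  For a coset `zH′_m`, `z ↔ (b,q,r,s)`:
`t·zH′_m = zH′_m ⟺ cond₂(z) ⟺ |bracket(s,q)| ≤ |ϖ^{2m+1}|` (★ (F2′), ★ (ii-a), cond₁ automatic ★ (ii-b), `|D_z| = 1` ★ `fixedPoint_expr00_eq_det_mul`)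
`⟺ |B(q∕s, N(s))| ≤ |ϖ^{2m+1}|` (★ `bracket_eq_of_div`) `⟺ P(q∕s mod 𝔭^m)` with **`P(ū) :⟺ ∀ u ∈ ū, |B(u, (1 + 4ϖN(u))⁻¹)| ≤ |ϖ^{2m+1}|`** (★ `v_bracket_sub_bracket_le`,
★ `v_norm_sub_norm_le`: the value of `B` moves by `≤ |ϖ^{2m+1}|` along a class).  Transporting along ★ 2e-γ's bijection `e` (first coordinate `q∕s`):
`Fix_t ≃ {x : (𝒪⧸𝔭^m) × N₁ // P x.1} ≃ {ū // P ū} × N₁`, so **`#Fix_t(S ⧸ H′_m) = #{ū // P ū} · #N₁`**, `#N₁ = q^{2m}(q+1)` (★ B-p10 `natCard_norm_fibre_quotient_pow_two_mul_add_one`).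

## References
* [Flicker1998UnitaryFL] Y. Z. Flicker, *Elementary proof of the fundamental lemma for a unitary group*, Canad. J. Math. 50 (1998), Prop. 16 p. 96.
-/

set_option autoImplicit false

noncomputable section

open scoped MatrixGroups WithZero Valued
open Matrix

namespace Literature.NumberTheory.Automorphic

namespace UnitaryGroup

open Literature.NumberTheory.Automorphic.HermitianLattice

variable {K : Type*} [Field K] [Valued K ℤᵐ⁰] {ϖ : K}
  (σ : K →+* K) {J : Matrix (Fin 3) (Fin 3) K} (hJ : J = (StdForm.antidiagonal 3).over K)

/-! ## §1 The fixed-point condition as a predicate on `q∕s mod 𝔭^m` -/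

/-- `n(u) := (1 + 4ϖN(u))⁻¹` satisfies `n(u)·(1 + 4ϖN(u)) = 1` and `|n(u)| ≤ 1` for integral `u`. [cite: Flicker1998UnitaryFL, Prop. 16 p. 96] -/
theorem inv_norm_factor_spec (hd : LocalConjDatum σ ϖ) {u : K} (hu : Valued.v u ≤ 1) :
    (1 + 4 * ϖ * (σ u * u))⁻¹ * (1 + 4 * ϖ * (σ u * u)) = 1 ∧ Valued.v ((1 + 4 * ϖ * (σ u * u))⁻¹) ≤ 1 := by
  have h4 : Valued.v (4 : K) = 1 := by rw [show (4 : K) = 2 * 2 by norm_num, map_mul, hd.v2, one_mul]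
  have hϖ1 : Valued.v ϖ < 1 := by rw [hd.vϖ, ← WithZero.exp_zero]; exact WithZero.exp_lt_exp.2 (by norm_num)
  have hsmall : Valued.v (4 * ϖ * (σ u * u)) < 1 := by
    rw [map_mul, map_mul, map_mul, h4, one_mul, hd.vσ]
    calc Valued.v ϖ * (Valued.v u * Valued.v u) ≤ Valued.v ϖ * (1 * 1) := mul_le_mul' le_rfl (mul_le_mul' hu hu)
      _ = Valued.v ϖ := by rw [mul_one, mul_one]
      _ < 1 := hϖ1
  have hw : Valued.v (1 + 4 * ϖ * (σ u * u)) = 1 := by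
    rw [Valuation.map_add_eq_of_lt_left _ (by rw [Valuation.map_one]; exact hsmall), Valuation.map_one]
  have hw0 : 1 + 4 * ϖ * (σ u * u) ≠ 0 := fun h0 => by rw [h0, map_zero] at hw; exact zero_ne_one hw
  exact ⟨inv_mul_cancel₀ hw0, by rw [map_inv₀, hw, inv_one]⟩

set_option synthInstance.maxHeartbeats 200000 in
-- the `↥S`-action on `↥S ⧸ H′_m` is slow to synthesise (as in ★ (F2′))
include hJ in
/-- **`t·zH′_m = zH′_m ⟺ P(q∕s mod 𝔭^m)`** for `m ≤ N`, with `P(ū) :⟺ ∀ u ∈ ū, |B(u, (1+4ϖN(u))⁻¹)| ≤ |ϖ^{2m+1}|` and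
`B(u,n) = (A_t − 1) − 4ϖ(A_t − s_t)N(u)·n − 4ϖ·n·(q_t σu − (A_t∕σs_t)·σq_t·u)`. [cite: Flicker1998UnitaryFL, Prop. 16 p. 96] -/
theorem smul_mk_eq_iff_forall_bracket_le (hd : LocalConjDatum σ ϖ) (d : ℕ → ↥(unitaryGroupOfForm σ J)) (m : ℕ)
    (hdm : ((d m : GL (Fin 3) K) : Matrix (Fin 3) (Fin 3) K) = !![ϖ ^ m, 0, 0; 0, 1, 0; 0, 0, (ϖ ^ m)⁻¹])
    {t : ↥(unitaryGroupOfForm σ J)} (ht : t ∈ MulAction.stabilizer (↥(unitaryGroupOfForm σ J)) (![1, 0, -(2 * ϖ)] : Fin 3 → K)) {bt qt rt st : K}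
    (htc : ((t : GL (Fin 3) K) : Matrix (Fin 3) (Fin 3) K) = !![1 + 2 * ϖ * bt, qt, bt; 2 * ϖ * rt, st, rt; 4 * ϖ ^ 2 * bt, 2 * ϖ * qt, 1 + 2 * ϖ * bt])
    (N : ℕ) (hmN : m ≤ N) (hqt : Valued.v qt = WithZero.exp (-(N : ℤ))) (hrt : Valued.v rt = WithZero.exp (-(N : ℤ)))
    (hAst : Valued.v ((1 + 4 * ϖ * bt) - st) ≤ WithZero.exp (-((N : ℤ) + 1)))
    {z : ↥(MulAction.stabilizer (↥(unitaryGroupOfForm σ J)) (![1, 0, -(2 * ϖ)] : Fin 3 → K))} {b q r s : K}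
    (hz : (((z : ↥(unitaryGroupOfForm σ J)) : GL (Fin 3) K) : Matrix (Fin 3) (Fin 3) K) =
      !![1 + 2 * ϖ * b, q, b; 2 * ϖ * r, s, r; 4 * ϖ ^ 2 * b, 2 * ϖ * q, 1 + 2 * ϖ * b]) :
    (⟨t, ht⟩ : ↥(MulAction.stabilizer (↥(unitaryGroupOfForm σ J)) (![1, 0, -(2 * ϖ)] : Fin 3 → K))) •
        (QuotientGroup.mk z : ↥(MulAction.stabilizer (↥(unitaryGroupOfForm σ J)) (![1, 0, -(2 * ϖ)] : Fin 3 → K)) ⧸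
          ((unitaryInt σ J).map (MulAut.conj (d m)).toMonoidHom).subgroupOf
            (MulAction.stabilizer (↥(unitaryGroupOfForm σ J)) (![1, 0, -(2 * ϖ)] : Fin 3 → K))) = QuotientGroup.mk z ↔
      ∀ u : 𝒪[K], Ideal.Quotient.mk (𝓂[K] ^ m) u = toQuotPow m (q / s) →
        Valued.v ((1 + 4 * ϖ * bt - 1) - 4 * ϖ * (1 + 4 * ϖ * bt - st) * (σ (u : K) * u) * (1 + 4 * ϖ * (σ (u : K) * u))⁻¹ -
          4 * ϖ * (1 + 4 * ϖ * (σ (u : K) * u))⁻¹ * (qt * σ (u : K) - (1 + 4 * ϖ * bt) / σ st * σ qt * u)) ≤ Valued.v (ϖ ^ (2 * m + 1)) := by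
  -- data of `t` and `z`
  obtain ⟨hst1, -, hAt, -⟩ := stabilizer_valuation_bounds σ hJ hd htc
  obtain ⟨hs, hq, hA, -⟩ := stabilizer_valuation_bounds σ hJ hd hz
  obtain ⟨-, hU2, -⟩ := stabilizer_unitarity_relations σ hJ hd hz
  have hs0 : s ≠ 0 := fun h0 => by rw [h0, map_zero] at hs; exact zero_ne_one hs
  have hσs : σ s ≠ 0 := fun h0 => hs0 (by have e := congrArg σ h0; rwa [hd.σσ, map_zero] at e)
  have hst0 : st ≠ 0 := fun h0 => by rw [h0, map_zero] at hst1; exact zero_ne_one hst1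
  have hσst : σ st ≠ 0 := fun h0 => hst0 (by have e := congrArg σ h0; rwa [hd.σσ, map_zero] at e)
  have hA0 : 1 + 4 * ϖ * b ≠ 0 := fun h0 => by rw [h0, map_zero] at hA; exact zero_ne_one hA
  have hρ : 4 * ϖ * r = -(4 * ϖ * (1 + 4 * ϖ * b) * σ q) / σ s := by rw [stabilizer_r_eq σ hJ hd hz]; field_simp
  have hρt : 4 * ϖ * rt = -(4 * ϖ * (1 + 4 * ϖ * bt) * σ qt) / σ st := by rw [stabilizer_r_eq σ hJ hd htc]; field_simp
  have hΔ : (1 + 4 * ϖ * b) * s - 4 * ϖ * r * q = (1 + 4 * ϖ * b) / σ s := by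
    have e := det_stabilizerModel_eq σ hJ hd hz
    rw [Matrix.det_fin_two_of] at e
    rw [← e]; ring
  have hvΔ : Valued.v ((1 + 4 * ϖ * b) * s - 4 * ϖ * r * q) = 1 := by rw [hΔ, map_div₀, hA, hd.vσ, hs, div_one]
  have hΔt : Valued.v ((1 + 4 * ϖ * bt) / σ st) ≤ 1 := by rw [map_div₀, hAt, hd.vσ, hst1, div_one]
  have key := fixedPoint_expr00_eq_det_mul σ ϖ (At := 1 + 4 * ϖ * bt) (qt := qt) (st := st) hA0 hσs hσst hΔ hρ hρt hU2
  rw [smul_mk_eq_iff_flickerDiag σ d m ⟨t, ht⟩ z, Subgroup.coe_mk, fixedPoint_mem_unitaryInt_iff σ hJ hd m hdm htc hz,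
    fixedPoint_cond01_iff σ hd hs hq N m hqt hrt hAst, and_iff_right hmN]
  have e2 : s * ((1 + 4 * ϖ * bt) * (1 + 4 * ϖ * b) + qt * (4 * ϖ * r)) - q * (4 * ϖ * rt * (1 + 4 * ϖ * b) + st * (4 * ϖ * r)) -
      ((1 + 4 * ϖ * b) * s - 4 * ϖ * q * r) =
      ((1 + 4 * ϖ * b) * s - 4 * ϖ * r * q) *
        ((1 + 4 * ϖ * bt - 1) - 4 * ϖ * (1 + 4 * ϖ * bt - st) * (σ q * q) -
          4 * ϖ * (qt * σ q * s - (1 + 4 * ϖ * bt) / σ st * (σ qt * q * σ s))) := by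
    linear_combination key
  rw [e2, map_mul, hvΔ, one_mul, bracket_eq_of_div σ ϖ hs0]
  -- now both sides speak about `B(u, n)`; compare along the class of `q∕s`
  have hu : Valued.v (q / s) ≤ 1 := by rw [map_div₀, hs, div_one]; exact hq
  have hn : Valued.v (σ s * s) ≤ 1 := by rw [map_mul, hd.vσ, hs, mul_one]
  have hU : σ s * s * (1 + 4 * ϖ * (σ (q / s) * (q / s))) = 1 := by
    rw [map_div₀]; field_simp; linear_combination hU2
  constructor
  · intro hB u huc
    obtain ⟨hUu, hnu⟩ := inv_norm_factor_spec σ hd u.2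
    have hcl : Valued.v (q / s - u) ≤ Valued.v (ϖ ^ m) :=
      (toQuotPow_eq_toQuotPow_iff hd.vϖ m hu u.2).1 (by rw [← huc, toQuotPow_of_le m u.2])
    have hpert := v_bracket_sub_bracket_le σ hd (At := 1 + 4 * ϖ * bt) (st := st) hu u.2 hn hnu hΔt N m hmN hqt hAst hcl
      ((v_norm_sub_norm_le σ hd hu u.2 hn hnu hU hUu).trans (mul_le_mul' le_rfl hcl))
    have tr : ∀ {x y : K} {C : ℤᵐ⁰}, Valued.v x ≤ C → Valued.v (x - y) ≤ C → Valued.v y ≤ C := fun {x y C} hx hxy => by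
      have e : y = x - (x - y) := by ring
      rw [e]; exact (Valuation.map_sub _ _ _).trans (max_le hx hxy)
    exact tr hB hpert
  · intro hall
    have hB := hall ⟨q / s, hu⟩ (by rw [toQuotPow_of_le m hu])
    obtain ⟨hUu, hnu⟩ := inv_norm_factor_spec σ hd hu
    have hcl : Valued.v (q / s - q / s) ≤ Valued.v (ϖ ^ m) := by rw [sub_self, map_zero]; exact zero_le
    have hpert := v_bracket_sub_bracket_le σ hd (At := 1 + 4 * ϖ * bt) (st := st) hu hu hn hnu hΔt N m hmN hqt hAst hcl
      ((v_norm_sub_norm_le σ hd hu hu hn hnu hU hUu).trans (mul_le_mul' le_rfl hcl))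
    have tr : ∀ {x y : K} {C : ℤᵐ⁰}, Valued.v y ≤ C → Valued.v (x - y) ≤ C → Valued.v x ≤ C := fun {x y C} hy hxy => by
      have e : x = y + (x - y) := by ring
      rw [e]; exact (Valuation.map_add _ _ _).trans (max_le hy hxy)
    exact tr hB hpert

/-! ## §2 The count as a product -/

set_option synthInstance.maxHeartbeats 200000 in
-- as above
include hJ in
/-- **PROP. 16 FOR `m ≤ N`, REDUCED TO RESIDUES: `#Fix_t(S ⧸ H′_m) = #{ū ∈ 𝒪⧸𝔭^m : P ū} · #{x̄ ∈ 𝒪⧸𝔭^{2m+1} : x̄·σ̄x̄ = 1}`** (`P` as in §1; the second factor is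
`q^{2m}(q+1)` by ★ B-p10 `natCard_norm_fibre_quotient_pow_two_mul_add_one`).  The summand of ★ (F2′), verbatim. [cite: Flicker1998UnitaryFL, Prop. 16 p. 96] -/
theorem natCard_fixedPoints_quotient_eq_mul (hd : LocalConjDatum σ ϖ) (hσO : ∀ y : 𝒪[K], (σ.comp 𝒪[K].subtype) y ∈ 𝒪[K])
    (d : ℕ → ↥(unitaryGroupOfForm σ J)) (m : ℕ)
    (hdm : ((d m : GL (Fin 3) K) : Matrix (Fin 3) (Fin 3) K) = !![ϖ ^ m, 0, 0; 0, 1, 0; 0, 0, (ϖ ^ m)⁻¹])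
    {t : ↥(unitaryGroupOfForm σ J)} (ht : t ∈ MulAction.stabilizer (↥(unitaryGroupOfForm σ J)) (![1, 0, -(2 * ϖ)] : Fin 3 → K)) {bt qt rt st : K}
    (htc : ((t : GL (Fin 3) K) : Matrix (Fin 3) (Fin 3) K) = !![1 + 2 * ϖ * bt, qt, bt; 2 * ϖ * rt, st, rt; 4 * ϖ ^ 2 * bt, 2 * ϖ * qt, 1 + 2 * ϖ * bt])
    (N : ℕ) (hmN : m ≤ N) (hqt : Valued.v qt = WithZero.exp (-(N : ℤ))) (hrt : Valued.v rt = WithZero.exp (-(N : ℤ)))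
    (hAst : Valued.v ((1 + 4 * ϖ * bt) - st) ≤ WithZero.exp (-((N : ℤ) + 1))) :
    Nat.card {z : ↥(MulAction.stabilizer (↥(unitaryGroupOfForm σ J)) (![1, 0, -(2 * ϖ)] : Fin 3 → K)) ⧸
          ((unitaryInt σ J).map (MulAut.conj (d m)).toMonoidHom).subgroupOf
            (MulAction.stabilizer (↥(unitaryGroupOfForm σ J)) (![1, 0, -(2 * ϖ)] : Fin 3 → K)) |
        (⟨t, ht⟩ : ↥(MulAction.stabilizer (↥(unitaryGroupOfForm σ J)) (![1, 0, -(2 * ϖ)] : Fin 3 → K))) • z = z} =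
      Nat.card {ū : 𝒪[K] ⧸ 𝓂[K] ^ m // ∀ u : 𝒪[K], Ideal.Quotient.mk (𝓂[K] ^ m) u = ū →
          Valued.v ((1 + 4 * ϖ * bt - 1) - 4 * ϖ * (1 + 4 * ϖ * bt - st) * (σ (u : K) * u) * (1 + 4 * ϖ * (σ (u : K) * u))⁻¹ -
            4 * ϖ * (1 + 4 * ϖ * (σ (u : K) * u))⁻¹ * (qt * σ (u : K) - (1 + 4 * ϖ * bt) / σ st * σ qt * u)) ≤ Valued.v (ϖ ^ (2 * m + 1))} *
        Nat.card {x : 𝒪[K] ⧸ 𝓂[K] ^ (2 * m + 1) //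
          x * Ideal.quotientMap (𝓂[K] ^ (2 * m + 1)) ((σ.comp 𝒪[K].subtype).codRestrict 𝒪[K] hσO)
            (maximalIdeal_pow_le_comap_codRestrict σ hd.vϖ hd.vσ hσO (2 * m + 1)) x = Ideal.Quotient.mk _ 1} := by
  obtain ⟨e, he⟩ := exists_equiv_stabilizer_quotient_conjInt σ hJ hd hσO d m hdm
  rw [← Nat.card_prod]
  refine Nat.card_congr ((Equiv.subtypeEquiv e fun w => ?_).trans (Equiv.prodSubtypeFstEquivSubtypeProd))
  -- the fixed-point condition on the coset `w` is `P` of the first coordinate of `e w`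
  induction w using QuotientGroup.induction_on with | H z => ?_
  obtain ⟨b, q, r, s, hz⟩ := exists_coords_of_mem_stabilizer σ hJ hd z
  rw [Set.mem_setOf_eq, smul_mk_eq_iff_forall_bracket_le σ hJ hd d m hdm ht htc N hmN hqt hrt hAst hz, he z b q r s hz]

/-! ## §3 (B-p10 (g25), p842096 — RESTORED VERBATIM) Prop. 16 row `[N∕2] < m ≤ N ∧ N < M`: `#Fix_t = (q+1)q^{N+2m}`

The two theorems below are B-p10 (g25)'s FILE 3 (iii-c) (proposal p842096, 2026-09-01T07:05:45Z), which A-p13 (g30)'s whole-file proposal p842099 of the same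
path overwrote 26 s later by a name collision; they are re-landed here byte-for-byte (authorship B-p10 (g25)).  B-p10's module note:

> # Flicker's Proposition 16, second row, on the coset space: for `[N∕2] < m ≤ N` and `N < M`, `#Fix_t(Stab(w₀) ⧸ H′_m) = (q+1)·q^{N+2m}`
> # (Flicker 1998, Prop. 16 p. 96)
>
> Topic `NumberTheory/Automorphic`; namespace `Literature.NumberTheory.Automorphic.UnitaryGroup`.  THEOREMS ONLY (no `def`, no instance, no notation, no named fact, no
> `sorry`); kernel lane; count-neutral.  Cell `pub/hodgecm-mathlib`, crux H413, line «N7nsCount», value stub `stub_irredGValueNeg` (κ = −1), LAYER B′ FILE 3 (iii-c)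
> (B-p10 (g25); design pen B-p14 (g31), T8-112 (2); Layer B′ pen A-p13 (g30)).  HONEST LABEL: HC_CM is proved only modulo the printed citations until rung 0 closes;
> this is the last per-`m` row of ONE value stub of #103-ns.
>
> * the classifying bijection `e : Stab(w₀) ⧸ H′_m ≃ (𝒪 ⧸ 𝔭^m) × {x̄ ∈ 𝒪 ⧸ 𝔭^{2m+1} : x̄·σ̄x̄ = 1}` with first coordinate `z ↦ q_z ∕ s_z mod 𝔭^m` is ★ A-p13 2e-γ
>   `exists_equiv_stabilizer_quotient_conjInt` (imported, not restated).
> * §1 `smul_mk_eq_iff_uForm` — for `m ≤ N`: `t·hH′_m = hH′_m ⟺ |E_t(q_h ∕ s_h)| ≤ |ϖ^{2m+1}|` (★ (F2′) `smul_mk_eq_iff_flickerDiag` → ★ (ii-a) → ★ (ii-b)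
>   `fixedPoint_cond01_iff` ∕ `fixedPoint_expr00_eq_det_mul` (`|Δ_h| = 1`) → ★ β-A `fixedPoint_expr00_eq_uForm`): condition 2 is a function of the first coordinate alone.
> * §2 **`natCard_fixedPoints_quotient_of_le_of_le`** — for `N ≤ 2m`, `m ≤ N`, `|A_t − 1| ≤ |ϖ|^{N+1}`: `Nat.card {z : ↥S ⧸ H′_m | t • z = z} = (q + 1) * q ^ (N + 2 * m)`:
>   through 2e-γ the fixed set is `{ū : C_t ū} × N₁`, `#{ū : C_t ū} = q^N` (★ β `natCard_toQuotPow_uForm_le_eq_pow`, class-constancy ★ β-A `uForm_le_iff_of_close`),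
>   `|N₁| = q^{2m}(q+1)` (★ B-p10 (g24) `natCard_norm_fibre_quotient_pow_two_mul_add_one`).  With ★ (iii-a) (`2m ≤ N`), ★ B-p14 p841907 ∕ ★ A-p13 `…CountHigh` (vanishing
>   rows) this completes the `iSixteenM` table of ★ `UnitOrbitalIntegralInertClosedFormsTypeTwo`; the sum over `m` is B-p14 (g31)'s L6.
>
> ## References
> * [Flicker1998UnitaryFL] Y. Z. Flicker, *Elementary proof of the fundamental lemma for a unitary group*, Canad. J. Math. 50 (1998), Prop. 16 p. 96.
> * [Serre1979] J.-P. Serre, *Local Fields*, GTM 67 (1979), Ch. V §2.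
-/

section RowTwo

open Literature.NumberTheory.LocalFields.UnramifiedQuadraticNorm

set_option synthInstance.maxHeartbeats 200000 in
-- the `↥S`-action on `↥S ⧸ H′_m` is slow to synthesise (as in ★ (F2′), ★ (iii-a))
include hJ in
/-- **`t·hH′_m = hH′_m ⟺ |E_t(q_h ∕ s_h)| ≤ |ϖ^{2m+1}|` for `m ≤ N`** (`t ∈ Stab(w₀)` of exponent `N`; `h` with coordinates `(b,q,r,s)`): condition 1 holds
(★ `fixedPoint_cond01_iff`), and condition 2 is `|Δ_h·E(q,s)|` with `|Δ_h| = 1` (★ `fixedPoint_expr00_eq_det_mul`) and `E(q,s) = E_t(q∕s)` (★ β-A `fixedPoint_expr00_eq_uForm`).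
[cite: Flicker1998UnitaryFL, Prop. 16 p. 96] -/
theorem smul_mk_eq_iff_uForm (hd : LocalConjDatum σ ϖ) (d : ℕ → ↥(unitaryGroupOfForm σ J)) (m : ℕ)
    (hdm : ((d m : GL (Fin 3) K) : Matrix (Fin 3) (Fin 3) K) = !![ϖ ^ m, 0, 0; 0, 1, 0; 0, 0, (ϖ ^ m)⁻¹])
    {t : ↥(unitaryGroupOfForm σ J)} (ht : t ∈ MulAction.stabilizer (↥(unitaryGroupOfForm σ J)) (![1, 0, -(2 * ϖ)] : Fin 3 → K)) {bt qt rt st : K}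
    (htc : ((t : GL (Fin 3) K) : Matrix (Fin 3) (Fin 3) K) = !![1 + 2 * ϖ * bt, qt, bt; 2 * ϖ * rt, st, rt; 4 * ϖ ^ 2 * bt, 2 * ϖ * qt, 1 + 2 * ϖ * bt])
    (N : ℕ) (hmN : m ≤ N) (hqt : Valued.v qt = WithZero.exp (-(N : ℤ))) (hrt : Valued.v rt = WithZero.exp (-(N : ℤ)))
    (hAst : Valued.v ((1 + 4 * ϖ * bt) - st) ≤ WithZero.exp (-((N : ℤ) + 1)))
    (h : ↥(MulAction.stabilizer (↥(unitaryGroupOfForm σ J)) (![1, 0, -(2 * ϖ)] : Fin 3 → K))) {b q r s : K}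
    (hh : (((h : ↥(unitaryGroupOfForm σ J)) : GL (Fin 3) K) : Matrix (Fin 3) (Fin 3) K) =
      !![1 + 2 * ϖ * b, q, b; 2 * ϖ * r, s, r; 4 * ϖ ^ 2 * b, 2 * ϖ * q, 1 + 2 * ϖ * b]) :
    (⟨t, ht⟩ : ↥(MulAction.stabilizer (↥(unitaryGroupOfForm σ J)) (![1, 0, -(2 * ϖ)] : Fin 3 → K))) • (QuotientGroup.mk h : ↥(MulAction.stabilizer (↥(unitaryGroupOfForm σ J)) (![1, 0, -(2 * ϖ)] : Fin 3 → K)) ⧸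
          ((unitaryInt σ J).map (MulAut.conj (d m)).toMonoidHom).subgroupOf
            (MulAction.stabilizer (↥(unitaryGroupOfForm σ J)) (![1, 0, -(2 * ϖ)] : Fin 3 → K))) = QuotientGroup.mk h ↔
      Valued.v ((1 + 4 * ϖ * bt - 1) - 4 * ϖ * (1 + 4 * ϖ * bt - st) * ((q / s * σ (q / s)) * (1 + 4 * ϖ * (q / s * σ (q / s)))⁻¹) -
          4 * ϖ * ((1 + 4 * ϖ * (q / s * σ (q / s)))⁻¹ * (qt * σ (q / s) - (1 + 4 * ϖ * bt) / σ st * (σ qt * (q / s))))) ≤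
        Valued.v (ϖ ^ (2 * m + 1)) := by
  -- data of `t` and `h`
  obtain ⟨hst1, -, hAt, -⟩ := stabilizer_valuation_bounds σ hJ hd htc
  obtain ⟨hs, hq, hA, -⟩ := stabilizer_valuation_bounds σ hJ hd hh
  obtain ⟨-, hU2, -⟩ := stabilizer_unitarity_relations σ hJ hd hh
  have hs0 : s ≠ 0 := fun h0 => by rw [h0, map_zero] at hs; exact zero_ne_one hs
  have hσs : σ s ≠ 0 := fun h0 => hs0 (by have e := congrArg σ h0; rwa [hd.σσ, map_zero] at e)
  have hst0 : st ≠ 0 := fun h0 => by rw [h0, map_zero] at hst1; exact zero_ne_one hst1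
  have hσst : σ st ≠ 0 := fun h0 => hst0 (by have e := congrArg σ h0; rwa [hd.σσ, map_zero] at e)
  have hA0 : 1 + 4 * ϖ * b ≠ 0 := fun h0 => by rw [h0, map_zero] at hA; exact zero_ne_one hA
  -- `ρ = 4ϖr = −4ϖAσq∕σs`, `ρ_t` likewise, `Δ = A s − ρ q = A∕σs`
  have hρ : 4 * ϖ * r = -(4 * ϖ * (1 + 4 * ϖ * b) * σ q) / σ s := by rw [stabilizer_r_eq σ hJ hd hh]; field_simp
  have hρt : 4 * ϖ * rt = -(4 * ϖ * (1 + 4 * ϖ * bt) * σ qt) / σ st := by rw [stabilizer_r_eq σ hJ hd htc]; field_simp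
  have hΔ : (1 + 4 * ϖ * b) * s - 4 * ϖ * r * q = (1 + 4 * ϖ * b) / σ s := by
    have e := det_stabilizerModel_eq σ hJ hd hh
    rw [Matrix.det_fin_two_of] at e
    rw [← e]; ring
  have hvΔ : Valued.v ((1 + 4 * ϖ * b) * s - 4 * ϖ * r * q) = 1 := by rw [hΔ, map_div₀, hA, hd.vσ, hs, div_one]
  have key := fixedPoint_expr00_eq_det_mul σ ϖ (At := 1 + 4 * ϖ * bt) (qt := qt) (st := st) hA0 hσs hσst hΔ hρ hρt hU2
  rw [smul_mk_eq_iff_flickerDiag σ d m ⟨t, ht⟩ h, Subgroup.coe_mk, fixedPoint_mem_unitaryInt_iff σ hJ hd m hdm htc hh,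
    fixedPoint_cond01_iff σ hd hs hq N m hqt hrt hAst, and_iff_right hmN]
  -- condition 2: factor `Δ_h` out, then read the bracket on `u = q∕s`
  have e2 : s * ((1 + 4 * ϖ * bt) * (1 + 4 * ϖ * b) + qt * (4 * ϖ * r)) - q * (4 * ϖ * rt * (1 + 4 * ϖ * b) + st * (4 * ϖ * r)) -
      ((1 + 4 * ϖ * b) * s - 4 * ϖ * q * r) =
      ((1 + 4 * ϖ * b) * s - 4 * ϖ * r * q) *
        ((1 + 4 * ϖ * bt - 1) - 4 * ϖ * (1 + 4 * ϖ * bt - st) * (σ q * q) -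
          4 * ϖ * (qt * σ q * s - (1 + 4 * ϖ * bt) / σ st * (σ qt * q * σ s))) := by
    linear_combination key
  rw [e2, map_mul, hvΔ, one_mul, fixedPoint_expr00_eq_uForm σ hd.σσ ϖ (1 + 4 * ϖ * bt) st qt ((1 + 4 * ϖ * bt) / σ st) hU2 hs0]

/-! ## §2 The count in the regime `[N∕2] < m ≤ N`, `N < M` -/

set_option synthInstance.maxHeartbeats 200000 in
-- as above
include hJ in
/-- **PROP. 16, SECOND ROW: for `N ≤ 2m`, `m ≤ N` and `|A_t − 1| ≤ |ϖ|^{N+1}` (`N < M`), `#Fix_t(Stab(w₀) ⧸ H′_m) = (q+1)·q^{N+2m}`** — through the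
classification `e` of ★ 2e-γ the fixed cosets are `{ū : C_t ū} × N₁` (§1 + ★ β-A `uForm_le_iff_of_close`), with `#{ū : C_t ū} = q^N` (★ β `natCard_toQuotPow_uForm_le_eq_pow`)
and `|N₁| = q^{2m}(q+1)` (★ `natCard_norm_fibre_quotient_pow_two_mul_add_one`).  The summand of ★ (F2′), verbatim; boundary `2m = N` agrees with ★ (iii-a).
[cite: Flicker1998UnitaryFL, Prop. 16 p. 96] [cite: Serre1979, Ch. V §2] -/
theorem natCard_fixedPoints_quotient_of_le_of_le (hd : LocalConjDatum σ ϖ) (hσO : ∀ y : 𝒪[K], (σ.comp 𝒪[K].subtype) y ∈ 𝒪[K])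
    [IsDiscreteValuationRing 𝒪[K]] [Finite (IsLocalRing.ResidueField 𝒪[K])] [IsAdicComplete 𝓂[K] 𝒪[K]]
    {a₀ : 𝒪[K]} (ha₀ : IsUnit (((σ.comp 𝒪[K].subtype).codRestrict 𝒪[K] hσO) a₀ - a₀)) {q : ℕ} (hq : Nat.card (IsLocalRing.ResidueField 𝒪[K]) = q ^ 2)
    (d : ℕ → ↥(unitaryGroupOfForm σ J)) (m : ℕ)
    (hdm : ((d m : GL (Fin 3) K) : Matrix (Fin 3) (Fin 3) K) = !![ϖ ^ m, 0, 0; 0, 1, 0; 0, 0, (ϖ ^ m)⁻¹])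
    {t : ↥(unitaryGroupOfForm σ J)} (ht : t ∈ MulAction.stabilizer (↥(unitaryGroupOfForm σ J)) (![1, 0, -(2 * ϖ)] : Fin 3 → K)) {bt qt rt st : K}
    (htc : ((t : GL (Fin 3) K) : Matrix (Fin 3) (Fin 3) K) = !![1 + 2 * ϖ * bt, qt, bt; 2 * ϖ * rt, st, rt; 4 * ϖ ^ 2 * bt, 2 * ϖ * qt, 1 + 2 * ϖ * bt])
    (N : ℕ) (hN2m : N ≤ 2 * m) (hmN : m ≤ N) (hqt : Valued.v qt = WithZero.exp (-(N : ℤ))) (hrt : Valued.v rt = WithZero.exp (-(N : ℤ)))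
    (hAst : Valued.v ((1 + 4 * ϖ * bt) - st) ≤ WithZero.exp (-((N : ℤ) + 1)))
    (hA1 : Valued.v ((1 + 4 * ϖ * bt) - 1) ≤ WithZero.exp (-((N : ℤ) + 1))) :
    Nat.card {z : ↥(MulAction.stabilizer (↥(unitaryGroupOfForm σ J)) (![1, 0, -(2 * ϖ)] : Fin 3 → K)) ⧸
          ((unitaryInt σ J).map (MulAut.conj (d m)).toMonoidHom).subgroupOf
            (MulAction.stabilizer (↥(unitaryGroupOfForm σ J)) (![1, 0, -(2 * ϖ)] : Fin 3 → K)) |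
        (⟨t, ht⟩ : ↥(MulAction.stabilizer (↥(unitaryGroupOfForm σ J)) (![1, 0, -(2 * ϖ)] : Fin 3 → K))) • z = z} = (q + 1) * q ^ (N + 2 * m) := by
  classical
  obtain ⟨e, he⟩ := exists_equiv_stabilizer_quotient_conjInt σ hJ hd hσO d m hdm
  -- data of `t`
  obtain ⟨hst1, hqt1, hAt, -⟩ := stabilizer_valuation_bounds σ hJ hd htc
  obtain ⟨-, hU2t, -⟩ := stabilizer_unitarity_relations σ hJ hd htc
  have hNt := stabilizer_norm_A_eq_norm_s σ hJ hd htc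
  -- the predicate on the first coordinate
  let C : 𝒪[K] ⧸ 𝓂[K] ^ m → Prop := fun x => ∃ u : K, Valued.v u ≤ 1 ∧ toQuotPow m u = x ∧
    Valued.v ((1 + 4 * ϖ * bt - 1) - 4 * ϖ * (1 + 4 * ϖ * bt - st) * ((u * σ u) * (1 + 4 * ϖ * (u * σ u))⁻¹) -
        4 * ϖ * ((1 + 4 * ϖ * (u * σ u))⁻¹ * (qt * σ u - (1 + 4 * ϖ * bt) / σ st * (σ qt * u)))) ≤ Valued.v (ϖ ^ (2 * m + 1))
  -- fixed ⟺ `C` of the first coordinate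
  have hcrit : ∀ z : ↥(MulAction.stabilizer (↥(unitaryGroupOfForm σ J)) (![1, 0, -(2 * ϖ)] : Fin 3 → K)) ⧸
      ((unitaryInt σ J).map (MulAut.conj (d m)).toMonoidHom).subgroupOf
            (MulAction.stabilizer (↥(unitaryGroupOfForm σ J)) (![1, 0, -(2 * ϖ)] : Fin 3 → K)),
      (⟨t, ht⟩ : ↥(MulAction.stabilizer (↥(unitaryGroupOfForm σ J)) (![1, 0, -(2 * ϖ)] : Fin 3 → K))) • z = z ↔ C (e z).1 := by
    intro z
    induction z using QuotientGroup.induction_on with | H h => ?_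
    obtain ⟨b, q', r, s, hh⟩ := exists_coords_of_mem_stabilizer σ hJ hd h
    obtain ⟨hs, hq', -, -⟩ := stabilizer_valuation_bounds σ hJ hd hh
    have hu : Valued.v (q' / s) ≤ 1 := by rw [map_div₀, hs, div_one]; exact hq'
    rw [smul_mk_eq_iff_uForm σ hJ hd d m hdm ht htc N hmN hqt hrt hAst h hh, he h b q' r s hh]
    constructor
    · intro hfix; exact ⟨q' / s, hu, rfl, hfix⟩
    · rintro ⟨u, hu1, hux, hCu⟩
      have hclose : Valued.v (u - q' / s) ≤ Valued.v (ϖ ^ m) := (toQuotPow_eq_toQuotPow_iff hd.vϖ m hu1 hu).1 hux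
      exact (uForm_le_iff_of_close σ hd (At := 1 + 4 * ϖ * bt) hNt hAt hst1 N (ε := qt / ϖ ^ N) (e := (1 + 4 * ϖ * bt - st) / ϖ ^ N)
        (by rw [mul_div_cancel₀ _ (pow_ne_zero _ hd.ϖ_ne_zero)]) (by rw [mul_div_cancel₀ _ (pow_ne_zero _ hd.ϖ_ne_zero)]) hqt hAst
        (m := m) (j := m) (by omega) hu1 hu hclose).1 hCu
  -- transport along `e`, split the product, count
  have hσOσ : ∀ z : 𝒪[K], ((σ.comp 𝒪[K].subtype).codRestrict 𝒪[K] hσO) (((σ.comp 𝒪[K].subtype).codRestrict 𝒪[K] hσO) z) = z :=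
    fun z => Subtype.ext (hd.σσ (z : K))
  calc Nat.card {z : ↥(MulAction.stabilizer (↥(unitaryGroupOfForm σ J)) (![1, 0, -(2 * ϖ)] : Fin 3 → K)) ⧸
            ((unitaryInt σ J).map (MulAut.conj (d m)).toMonoidHom).subgroupOf
            (MulAction.stabilizer (↥(unitaryGroupOfForm σ J)) (![1, 0, -(2 * ϖ)] : Fin 3 → K)) |
          (⟨t, ht⟩ : ↥(MulAction.stabilizer (↥(unitaryGroupOfForm σ J)) (![1, 0, -(2 * ϖ)] : Fin 3 → K))) • z = z}
      = Nat.card {x : (𝒪[K] ⧸ 𝓂[K] ^ m) × {x : 𝒪[K] ⧸ 𝓂[K] ^ (2 * m + 1) //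
            x * Ideal.quotientMap (𝓂[K] ^ (2 * m + 1)) ((σ.comp 𝒪[K].subtype).codRestrict 𝒪[K] hσO)
              (maximalIdeal_pow_le_comap_codRestrict σ hd.vϖ hd.vσ hσO (2 * m + 1)) x = Ideal.Quotient.mk _ 1} // C x.1} :=
        Nat.card_congr (e.subtypeEquiv fun z => hcrit z)
    _ = Nat.card {x : 𝒪[K] ⧸ 𝓂[K] ^ m // C x} * Nat.card {x : 𝒪[K] ⧸ 𝓂[K] ^ (2 * m + 1) //
            x * Ideal.quotientMap (𝓂[K] ^ (2 * m + 1)) ((σ.comp 𝒪[K].subtype).codRestrict 𝒪[K] hσO)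
              (maximalIdeal_pow_le_comap_codRestrict σ hd.vϖ hd.vσ hσO (2 * m + 1)) x = Ideal.Quotient.mk _ 1} := by
        rw [← Nat.card_prod]; exact Nat.card_congr (Equiv.prodSubtypeFstEquivSubtypeProd)
    _ = q ^ N * (q ^ (2 * m) * (q + 1)) := by
        rw [natCard_toQuotPow_uForm_le_eq_pow σ hd hσO ha₀ hq hNt hU2t hAt hst1 hqt hAst hA1 hN2m hmN,
          natCard_norm_fibre_quotient_pow_two_mul_add_one _ hσOσ ha₀ hq m isUnit_one (map_one _)]
    _ = (q + 1) * q ^ (N + 2 * m) := by ring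

end RowTwo

end UnitaryGroup

end Literature.NumberTheory.Automorphic

end
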